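import Summits.QuantumFields.YangMills.Theorems.BalabanUVNodesK0FlatPortKernelRowsP
import Summits.QuantumFields.YangMills.Theorems.BalabanUVNodesK0FlatOpsHRowsFromKernelsP
import Summits.QuantumFields.YangMills.Theorems.UnitScaleTiltProp8FlatCubeQContraction
import Summits.QuantumFields.YangMills.Theorems.UnitScaleTiltProp8FlatPortRechart
import HarnessLib

/-!
# K0⁷ `stub_prop8StepCoP13` (stmt-QuantumFields-20541), sub-target S5, S5 ROAD item (b) — the d-generic port, file P8 (ASSEMBLY ∕ BODY):
# **THE BODY OF THE P2 TEXT (`K0FlatCubeOpsTextP.BodyAt`: the canonical `H`, `G̃ = G − HQG` pinned, the guarded (46)∕`hG`∕Laplacian letters, a distance `dBI ≥ distBI` with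
# (162) and the four (161)₁ rows) HOLDS AT EVERY (2.1)–(2.2)-ADMISSIBLE NESTED FAMILY — UNIT CUBES `Λ₀` ALLOWED — ON THE TORI `PV d ℓ m K` OF EVERY DIMENSION `d + 1`,
# EVERY ODD `L ≥ 5`, `≥ 5L` BIG BLOCKS PER DIRECTION; IN PARTICULAR ON NODE 00's four-tori `T4Family.P K` (`body_of_adm22_T4`)** — carrier-generic twin of ym3-torus's
# `UnitScaleTiltProp8FlatPortBodyL0` + `…FlatPortRechartL0` + the assembly lemmas of `…FlatOpsLettersAssembly` §4–§5, `…FlatOpsFromKernelRows`, `…FlatCubeQContraction` §4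

Cell `pub-ymgap`, width seat `pub-ymgap-k0-s1-w3` gen 2 (D-0149; START LIST v7 §k0-s1 S5 ROAD item (b), plan g80 WORDS-1b l.25728).  `--kind proof --supports
stmt-QuantumFields-20541 --as helper`; count-neutral; def-free.  Proofs VERBATIM after the carrier substitution `(F : T3Family, n, K) ↦ (P : Params, k)` ∕ `PV 2 ↦ PV d`;
the carrier-free and carrier-generic lemmas of the UST files (`Qfun`, `abs_Qfun_le`, `le_levOf_succ_of_adm22`, `adm22_of_dvd`, `Gt_eq_Gt`, `hOp_eq_hOp`) are consumed BY NAME.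

WHAT IS PROVED (sorry-free; axioms standard; no definition): `qContrLetter_of_adm22` (the contraction row, `C_Q = L`) · `gtSupLetterG_gtOf` · `gtLaplaceLetterG_gtOf` · `body_of_rowsAt`
(`RowsAt ⇒ BodyAt` at the constant `max B₀ (C_G + B₀·C_Q·C_G)`) · `rowsAt_of_kernelRowsAt` · **`rowsAt_of_adm22`** · **`body_of_adm22`** (every `Adm22 D R (L·M_h)` family on
`PV d ℓ m K`, odd `L = ℓ+1 ≥ 5`, heights `1 ≤ K − n`, `K − n + 1 ≤ m + K`, `M_h = L^{a′} ≥ M_h⁰`, `R ≥ R₀`, `a′ + 3 ≤ m + n`) · `kernelRowsAt_of_adm22_pow` (re-chart to `M = Lᵃ`) ·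
★ **`body_of_adm22_T4`** — THE SAME ON NODE 00's TORI `F.P K`, `F : T4Family` (d = 4, `L > 11`; by `K0FlatCubeOpsTextP.P_mk_eq_PV`, i.e. `rfl`).
HONEST SCOPE: what separates this from a text quantified over ALL admissible families is exactly (i) `L ≥ 5` (T⁴ has `L > 11`) and (ii) tori below `5L` big blocks per
direction (`a′ + 3 ≤ m + n`) — the UST sub-gaps (P2-L3)∕(P2-small), inherited.  Nothing of [Balaban1985Variational] Sect. F itself ((144)–(160), (165)–(168)) is touched;
the Literature content is lit-balaban's k-level [Balaban1984PropagatorsII] chain, consumed by name.  Count-neutral; K0⁷ OPEN; N07 NOT discharged (5∕27 unmoved); R4 closes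
the conditional finite-𝕋⁴ rung `BalabanLadder.UV` only — the YM mass gap (Clay) is NOT proved by any of this; nothing continuum ∕ ℝ⁴ ∕ OS.

References: T. Bałaban, CMP **102** (1985) 277–309 [Balaban1985Variational] (46) p.285, (130) p.298, (143) p.300, (157)–(158) p.302, (161)–(163) p.303, (165) p.304; CMP **96**
(1984) 223–250 [Balaban1984PropagatorsII] (2.1)–(2.2) p.224, (2.20) p.226, Prop. 2.6 (2.136) p.247, Cor. 2.8 (2.150)–(2.151) p.249; CMP **95** (1984) 17–40
[Balaban1984PropagatorsI] (1.18) p.20; CMP **109** (1987) 249–301 [Balaban1987RG1] (0.1) p.251.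
-/

set_option autoImplicit false

noncomputable section

open scoped BigOperators

namespace Summit.QuantumFields.YangMills.Theorems.K0FlatPortBodyP

open Literature.MathematicalPhysics.QuantumFieldTheory.Balaban1983to89
open B5Eq118OneStroke (iterBlockOf)
open B6GlobalChartV1 (PV)
open B6SectADomainsV1 (Domains)
open B6SectAOperatorsV1 (BondIdx)
open T4Continuum (T4Family)
open Summit.QuantumFields.YangMills.Theorems.FlatCubeOpsText (Adm22 distBI)
open Summit.QuantumFields.YangMills.Theorems.FlatOpsLettersAssembly (Qfun)
open Summit.QuantumFields.YangMills.Theorems.FlatCubeQContraction (abs_Qfun_le le_levOf_succ_of_adm22)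
open Summit.QuantumFields.YangMills.Theorems.FlatPortRechart (adm22_of_dvd)
open Summit.QuantumFields.YangMills.Theorems.K0FlatCubeOpsTextP (IsLevWeight IsFlatH IsFlatGt flatH isFlatH_flatH IsFlatGW gtOf gtOf_apply isFlatGt_gtOf
  HSupLetterG HLapLetterG GtSupLetterG GtLaplaceLetterG HDecayLetterD RowSum162 QContrLetter KernelRowsAt HRowsAt RowsAt BodyAt levWeight_nonneg
  hSupLetterG_mono hLapLetterG_mono gtSupLetterG_mono gtLaplaceLetterG_mono hDecayLetterD_mono)
open Summit.QuantumFields.YangMills.Theorems.K0FlatOpsHRowsFromKernelsP (hRows_of_kernelRows)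
open Summit.QuantumFields.YangMills.Theorems.K0FlatPortKernelRowsP (kernelRowsAt_of_adm22)

/-! ## §1 The contraction row of `Q` at every admissible family (`C_Q = L`) -/

section QRow

variable {P : Params} {k : ℕ} {D : Domains P}

/-- **THE CONTRACTION ROW OF `RowsAt` FOR EVERY ADMISSIBLE FAMILY, `C_Q = L`**: under `Adm22 D R M` with `R·M ≥ 2L` (and `D.k = K − n`, the text's binders), the
P2 level weights satisfy `(L^{j(c)}η)|(Qu)(c)| ≤ L·sup_b (L^{j(b)}η)|u(b)|` — the sup-contraction of §1 and the level drop of at most one across an index bond.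
[cite: Balaban1984PropagatorsII, (2.2) p.224, (2.20) p.226; Balaban1984PropagatorsI, (1.18) p.20; Balaban1985Variational, p.286] -/
theorem qContrLetter_of_adm22 (hDk : D.k = k) {R M : ℕ} (hAdm : Adm22 D R M) (hRM : 2 * P.L ≤ R * M)
    (w : ℕ → PBond P 0 → ℝ) (hw : IsLevWeight P k D w) : QContrLetter P k D w (P.L : ℝ) := by
  intro u r hr hu c
  have hL1 : (1 : ℝ) ≤ (P.L : ℝ) := by exact_mod_cast P.hL.2.le
  have hL0 : (0 : ℝ) < (P.L : ℝ) := lt_of_lt_of_le zero_lt_one hL1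
  have hjk : (c.1.1 : ℕ) ≤ D.k := Nat.lt_succ_iff.1 c.1.1.isLt
  set ω : ℝ := (P.L : ℝ) ^ ((c.1.1 : ℕ)) * ((P.L : ℝ)⁻¹) ^ k with hω
  have hω0 : 0 < ω := by positivity
  -- on the fine bonds under the end-points of `c`: `ω·|u b| ≤ L·w₁(b)·|u b| ≤ L·r`
  have hub : ∀ b : PBond P 0, (iterBlockOf (c.1.1 : ℕ) b.src = c.1.2.src ∨ iterBlockOf (c.1.1 : ℕ) b.src = c.1.2.tgt) →
      |u b| ≤ (P.L : ℝ) * r / ω := by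
    intro b hb
    have hlev := le_levOf_succ_of_adm22 D hAdm (by simpa using hRM) hDk hjk c.2 b.src hb
    have hwb : ω ≤ (P.L : ℝ) * w 1 b := by
      rw [hw 1 b, pow_one, hω, ← mul_assoc, ← pow_succ']
      exact mul_le_mul_of_nonneg_right (pow_le_pow_right₀ hL1 hlev) (by positivity)
    rw [le_div_iff₀ hω0]
    calc |u b| * ω ≤ |u b| * ((P.L : ℝ) * w 1 b) := mul_le_mul_of_nonneg_left hwb (abs_nonneg _)
      _ = (P.L : ℝ) * (w 1 b * |u b|) := by ring
      _ ≤ (P.L : ℝ) * r := mul_le_mul_of_nonneg_left (hu b) hL0.le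
  have hQ : |Qfun D u c| ≤ (P.L : ℝ) * r / ω := abs_Qfun_le D u c fun b hb _ => hub b hb
  have := (le_div_iff₀ hω0).1 hQ
  calc ω * |Qfun D u c| = |Qfun D u c| * ω := mul_comm _ _
    _ ≤ (P.L : ℝ) * r := this


end QRow

/-! ## §4 The letters of `G̃ = G − HQG` from the rows of `G`, `Q`, `H` -/

section Assembly

variable {P : Params} {k : ℕ} {D : Domains P} {w : ℕ → PBond P 0 → ℝ}

/-- **THE `(−3) → (−1), (−2)` LETTERS OF `G̃ = G − HQG`** from the same letters of `G`, the contraction of `Q` and (46) for `H` (triangle inequality; the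
pattern of `FlatConstrainedPropagatorLetters.letters_G_sub_HQG` in the guarded multi-weight shapes): `G̃` carries the constant `C_G + B_H·C_Q·C_G`.
[cite: Balaban1985Variational, (143) p.300, (158) p.302, (165) p.304; Balaban1984PropagatorsII, Prop. 2.6 (2.136) p.247] -/
theorem gtSupLetterG_gtOf (hw0 : ∀ m b, 0 ≤ w m b) {G : (PBond P 0 → ℝ) →ₗ[ℝ] (PBond P 0 → ℝ)} {CG CQ BH : ℝ}
    (hCG : 0 ≤ CG) (hCQ : 0 ≤ CQ) (hG : GtSupLetterG P k w G CG) (hQ : QContrLetter P k D w CQ)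
    (hH : HSupLetterG P k D w (flatH P k D) BH) :
    GtSupLetterG P k w (gtOf P k D G) (CG + BH * CQ * CG) := by
  intro f β hβ hf
  obtain ⟨hG0, hG1⟩ := hG f β hβ hf
  have hQG := hQ (G f) (CG * β) (mul_nonneg hCG hβ) hG0
  obtain ⟨hH0, hH1⟩ := hH (Qfun D (G f)) (CQ * (CG * β)) (mul_nonneg hCQ (mul_nonneg hCG hβ)) hQG
  refine ⟨fun b => ?_, fun b ν => ?_⟩
  · rw [gtOf_apply]
    calc w 1 b * |G f b - flatH P k D (Qfun D (G f)) b|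
        ≤ w 1 b * (|G f b| + |flatH P k D (Qfun D (G f)) b|) := mul_le_mul_of_nonneg_left (abs_sub _ _) (hw0 1 b)
      _ = w 1 b * |G f b| + w 1 b * |flatH P k D (Qfun D (G f)) b| := mul_add _ _ _
      _ ≤ CG * β + BH * (CQ * (CG * β)) := add_le_add (hG0 b) (hH0 b)
      _ = (CG + BH * CQ * CG) * β := by ring
  · rw [gtOf_apply, gtOf_apply]
    have e : G f ⟨b.src.shift ν, b.dir⟩ - flatH P k D (Qfun D (G f)) ⟨b.src.shift ν, b.dir⟩ - (G f b - flatH P k D (Qfun D (G f)) b) =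
        (G f ⟨b.src.shift ν, b.dir⟩ - G f b) - (flatH P k D (Qfun D (G f)) ⟨b.src.shift ν, b.dir⟩ - flatH P k D (Qfun D (G f)) b) := by
      ring
    rw [e]
    have hw2 : 0 ≤ w 2 b * (P.L : ℝ) ^ k := mul_nonneg (hw0 2 b) (pow_nonneg (Nat.cast_nonneg _) _)
    calc w 2 b * (P.L : ℝ) ^ k *
          |(G f ⟨b.src.shift ν, b.dir⟩ - G f b) - (flatH P k D (Qfun D (G f)) ⟨b.src.shift ν, b.dir⟩ - flatH P k D (Qfun D (G f)) b)|
        ≤ w 2 b * (P.L : ℝ) ^ k *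
          (|G f ⟨b.src.shift ν, b.dir⟩ - G f b| + |flatH P k D (Qfun D (G f)) ⟨b.src.shift ν, b.dir⟩ - flatH P k D (Qfun D (G f)) b|) :=
          mul_le_mul_of_nonneg_left (abs_sub _ _) hw2
      _ = w 2 b * (P.L : ℝ) ^ k * |G f ⟨b.src.shift ν, b.dir⟩ - G f b| +
          w 2 b * (P.L : ℝ) ^ k * |flatH P k D (Qfun D (G f)) ⟨b.src.shift ν, b.dir⟩ - flatH P k D (Qfun D (G f)) b| := mul_add _ _ _
      _ ≤ CG * β + BH * (CQ * (CG * β)) := add_le_add (hG1 b ν) (hH1 b ν)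
      _ = (CG + BH * CQ * CG) * β := by ring

/-- **THE LAPLACIAN LETTER OF `G̃ = G − HQG`** from the Laplacian row of `G` ((2.136)₄), the `(−3) → (−1)` row of `G` feeding `Q`, the contraction of `Q`, and the
Laplacian row (130) of `H`: constant `C_Δ + B_Δ·C_Q·C_G`. [cite: Balaban1985Variational, (165) p.304, (130) p.298; Balaban1984PropagatorsII, Prop. 2.6 (2.136) p.247] -/
theorem gtLaplaceLetterG_gtOf (hw0 : ∀ m b, 0 ≤ w m b) {G : (PBond P 0 → ℝ) →ₗ[ℝ] (PBond P 0 → ℝ)} {CG CL CQ BL : ℝ}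
    (hCG : 0 ≤ CG) (hCQ : 0 ≤ CQ) (hG : GtSupLetterG P k w G CG) (hGL : GtLaplaceLetterG P k w G CL) (hQ : QContrLetter P k D w CQ)
    (hHL : HLapLetterG P k D w (flatH P k D) BL) :
    GtLaplaceLetterG P k w (gtOf P k D G) (CL + BL * CQ * CG) := by
  intro f β hβ hf b
  obtain ⟨hG0, _⟩ := hG f β hβ hf
  have hQG := hQ (G f) (CG * β) (mul_nonneg hCG hβ) hG0
  have hL := hGL f β hβ hf b
  have hH := hHL (Qfun D (G f)) (CQ * (CG * β)) (mul_nonneg hCQ (mul_nonneg hCG hβ)) hQG b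
  set u : PBond P 0 → ℝ := G f with hu
  set v : PBond P 0 → ℝ := flatH P k D (Qfun D (G f)) with hv
  have e : ∑ ν : Fin P.d, ((gtOf P k D G f b - gtOf P k D G f ⟨b.src.shift ν, b.dir⟩) +
        (gtOf P k D G f b - gtOf P k D G f ⟨b.src.unshift ν, b.dir⟩)) =
      ∑ ν : Fin P.d, ((u b - u ⟨b.src.shift ν, b.dir⟩) + (u b - u ⟨b.src.unshift ν, b.dir⟩)) -
        ∑ ν : Fin P.d, ((v b - v ⟨b.src.shift ν, b.dir⟩) + (v b - v ⟨b.src.unshift ν, b.dir⟩)) := by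
    rw [← Finset.sum_sub_distrib]
    refine Finset.sum_congr rfl fun ν _ => ?_
    simp only [gtOf_apply, hu, hv]
    ring
  rw [e]
  have hw3 : 0 ≤ w 3 b * ((P.L : ℝ) ^ k) ^ 2 := mul_nonneg (hw0 3 b) (pow_nonneg (pow_nonneg (Nat.cast_nonneg _) _) _)
  calc w 3 b * ((P.L : ℝ) ^ k) ^ 2 *
        |∑ ν : Fin P.d, ((u b - u ⟨b.src.shift ν, b.dir⟩) + (u b - u ⟨b.src.unshift ν, b.dir⟩)) -
          ∑ ν : Fin P.d, ((v b - v ⟨b.src.shift ν, b.dir⟩) + (v b - v ⟨b.src.unshift ν, b.dir⟩))|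
      ≤ w 3 b * ((P.L : ℝ) ^ k) ^ 2 *
        (|∑ ν : Fin P.d, ((u b - u ⟨b.src.shift ν, b.dir⟩) + (u b - u ⟨b.src.unshift ν, b.dir⟩))| +
          |∑ ν : Fin P.d, ((v b - v ⟨b.src.shift ν, b.dir⟩) + (v b - v ⟨b.src.unshift ν, b.dir⟩))|) :=
        mul_le_mul_of_nonneg_left (abs_sub _ _) hw3
    _ = w 3 b * ((P.L : ℝ) ^ k) ^ 2 * |∑ ν : Fin P.d, ((u b - u ⟨b.src.shift ν, b.dir⟩) + (u b - u ⟨b.src.unshift ν, b.dir⟩))| +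
        w 3 b * ((P.L : ℝ) ^ k) ^ 2 * |∑ ν : Fin P.d, ((v b - v ⟨b.src.shift ν, b.dir⟩) + (v b - v ⟨b.src.unshift ν, b.dir⟩))| :=
        mul_add _ _ _
    _ ≤ CL * β + BL * (CQ * (CG * β)) := add_le_add hL hH
    _ = (CL + BL * CQ * CG) * β := by ring

end Assembly


/-! ## §3 The body from the row list; the row list from the kernel rows -/

section Lists

variable {P : Params} {k : ℕ} {D : Domains P}

/-- **THE BODY OF `FlatOpsAdmAtMS` AT ONE DATUM FROM ITS ROW LIST**: with nonnegative weights and `C_G, C_Q ≥ 0`, `RowsAt … B₀ δ₀ B₃ C_G C_Q` yields the canonical pair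
`(flatH, gtOf G)` pinned as `IsFlatH`/`IsFlatGt` with the text's five letters at the constant `max B₀ (C_G + B₀·C_Q·C_G)` and the same `dBI`, `δ₀`, `B₃`.
[cite: Balaban1985Variational, (46) p.285, (130) p.298, (143) p.300, (158) p.302, (161)-(163) p.303, (165) p.304; Balaban1984PropagatorsII, Prop. 2.6 (2.136) p.247, Cor. 2.8 p.249] -/
theorem body_of_rowsAt {w : ℕ → PBond P 0 → ℝ} (hw0 : ∀ m b, 0 ≤ w m b) {B₀ δ₀ B₃ CG CQ : ℝ} (hCG : 0 ≤ CG) (hCQ : 0 ≤ CQ)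
    (h : RowsAt P k D w B₀ δ₀ B₃ CG CQ) :
    ∃ (H : (BondIdx D → ℝ) →ₗ[ℝ] (PBond P 0 → ℝ)) (Gt : (PBond P 0 → ℝ) →ₗ[ℝ] (PBond P 0 → ℝ)),
      IsFlatH P k D H ∧ IsFlatGt P k D Gt ∧
      HSupLetterG P k D w H (max B₀ (CG + B₀ * CQ * CG)) ∧ GtSupLetterG P k w Gt (max B₀ (CG + B₀ * CQ * CG)) ∧
        GtLaplaceLetterG P k w Gt (max B₀ (CG + B₀ * CQ * CG)) ∧
      ∃ dBI : PBond P 0 → BondIdx D → ℝ,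
        (∀ b c, distBI D b c ≤ dBI b c) ∧ RowSum162 P k D dBI w δ₀ B₃ ∧ HDecayLetterD P k D dBI w H (max B₀ (CG + B₀ * CQ * CG)) δ₀ := by
  obtain ⟨⟨hHsup, hHlap, dBI, hcomp, hrow, hHdec⟩, ⟨w', hw', G, hGpin, hGsup, hGlap⟩, hQ⟩ := h
  refine ⟨flatH P k D, gtOf P k D G, isFlatH_flatH P k D, isFlatGt_gtOf P k D hw' hGpin,
    hSupLetterG_mono hHsup (le_max_left _ _), ?_, ?_, dBI, hcomp, hrow, hDecayLetterD_mono hHdec (le_max_left _ _)⟩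
  · exact gtSupLetterG_mono (gtSupLetterG_gtOf hw0 hCG hCQ hGsup hQ hHsup) (le_max_right _ _)
  · exact gtLaplaceLetterG_mono (gtLaplaceLetterG_gtOf hw0 hCG hCQ hGsup hGlap hQ hHlap) (le_max_right _ _)

/-- **`KernelRowsAt ⇒ RowsAt`** under the text's binders and `R·M ≥ 2L` (the Q-row with `C_Q = L`, the `H`-letters at `max C (C·B₃)`).
[cite: Balaban1984PropagatorsII, (2.2) p.224, Prop. 2.6 (2.136) p.247, Cor. 2.8 (2.150)-(2.151) p.249; Balaban1985Variational, (46) p.285, (130) p.298, (161)-(162) p.303] -/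
theorem rowsAt_of_kernelRowsAt {w : ℕ → PBond P 0 → ℝ} (hw : IsLevWeight P k D w) (hDk : D.k = k) {R M : ℕ} (hAdm : Adm22 D R M)
    (hRM : 2 * P.L ≤ R * M) {C δ₀ B₃ CG : ℝ} (hC : 0 ≤ C) (hδ₀ : 0 ≤ δ₀) (h : KernelRowsAt P k D w C δ₀ B₃ CG) :
    RowsAt P k D w (max C (C * B₃)) δ₀ B₃ CG (P.L : ℝ) := by
  obtain ⟨⟨dBI, hcomp, hrow, hk⟩, hG⟩ := h
  obtain ⟨h1, h2, h3, h4, h5⟩ := hRows_of_kernelRows hw hDk hC (by linarith) hcomp hk hrow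
  exact ⟨⟨h1, h2, dBI, h3, h4, h5⟩, hG, qContrLetter_of_adm22 hDk hAdm hRM w hw⟩


end Lists

/-! ## §4 Every admissible family on `PV d ℓ m K` (odd `L ≥ 5`, `≥ 5L` big blocks per direction) -/

/-- **THE FULL ROW LIST `RowsAt` AT EVERY ADMISSIBLE DATUM — NO `Ω₁ = T` HYPOTHESIS, unit cubes `Λ₀` allowed** (tori with `≥ 5L` big blocks per direction, odd `L ≥ 5`), `C_Q = L`.
[cite: Balaban1984PropagatorsII, (2.1)-(2.2) p.224, Prop. 2.6 (2.136) p.247, Cor. 2.8 (2.150)-(2.151) p.249; Balaban1985Variational, (46) p.285, (130) p.298, (161)-(163) p.303] -/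
theorem rowsAt_of_adm22 (d ℓ : ℕ) (hd : 1 ≤ d + 1) (hL : Odd (ℓ + 1) ∧ 1 < ℓ + 1) (hℓ : 4 ≤ ℓ) :
    ∃ (Mh₀ R₀ : ℕ) (C δ₀ B₃ CG : ℝ), 0 ≤ C ∧ 0 < δ₀ ∧ 0 < B₃ ∧ 0 ≤ CG ∧
    ∀ (m : ℕ) (n K : ℕ) (_ : 1 ≤ K - n) (_ : K - n + 1 ≤ m + K) {Mh R a' : ℕ} (_ : Mh = (ℓ + 1) ^ a') (_ : Mh₀ ≤ Mh) (_ : R₀ ≤ R) (_ : a' + 3 ≤ m + n)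
      (D : Domains (PV d ℓ m K hd hL)) (_ : D.k = K - n) (_ : Adm22 D R ((ℓ + 1) * Mh))
      (w : ℕ → PBond (PV d ℓ m K hd hL) 0 → ℝ) (_ : IsLevWeight (PV d ℓ m K hd hL) (K - n) D w),
      RowsAt (PV d ℓ m K hd hL) (K - n) D w (max C (C * B₃)) δ₀ B₃ CG (((ℓ + 1 : ℕ) : ℝ)) := by
  obtain ⟨Mh₀, R₀, C, δ₀, B₃, CG, hC, hδ₀, hB₃, hCG, hmain⟩ := kernelRowsAt_of_adm22 d ℓ hd hL hℓ
  refine ⟨max Mh₀ 2, max R₀ 1, C, δ₀, B₃, CG, hC, hδ₀, hB₃, hCG, ?_⟩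
  intro m n K hk1 hk' Mh R a' hMha hMh hR hsize D hDk hAdm w hw
  have hKR := hmain m n K hk1 hk' hMha (le_trans (le_max_left _ _) hMh) (le_trans (le_max_left _ _) hR) hsize D hDk hAdm w hw
  have hRM : 2 * (PV d ℓ m K hd hL).L ≤ R * ((ℓ + 1) * Mh) := by
    show 2 * (ℓ + 1) ≤ R * ((ℓ + 1) * Mh)
    have hR1 : 1 ≤ R := le_trans (le_max_right _ _) hR
    have hM2 : 2 ≤ Mh := le_trans (le_max_right _ _) hMh
    calc 2 * (ℓ + 1) = 1 * ((ℓ + 1) * 2) := by ring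
      _ ≤ R * ((ℓ + 1) * Mh) := Nat.mul_le_mul hR1 (Nat.mul_le_mul_left _ hM2)
  exact rowsAt_of_kernelRowsAt hw hDk hAdm hRM hC hδ₀.le hKR

/-- **THE BODY OF THE REGISTERED P2 TEXT AT EVERY ADMISSIBLE DATUM — NO `Ω₁ = T` HYPOTHESIS, unit cubes `Λ₀` allowed** (tori with `≥ 5L` big blocks per direction, odd `L ≥ 5`): the canonical `H`, `G̃`
(pinned), the guarded (46)/`hG`/Laplacian letters at one constant `B₀(L)`, and a distance `dBI ≥ distBI` carrying (162) and the four (161)₁ rows at rate `δ₀(L)`.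
[cite: Balaban1985Variational, (46) p.285, (130) p.298, (157)-(158) p.302, (161)-(163) p.303, (165) p.304; Balaban1984PropagatorsII, Prop. 2.6 (2.136) p.247, Cor. 2.8 p.249] -/
theorem body_of_adm22 (d ℓ : ℕ) (hd : 1 ≤ d + 1) (hL : Odd (ℓ + 1) ∧ 1 < ℓ + 1) (hℓ : 4 ≤ ℓ) :
    ∃ (Mh₀ R₀ : ℕ) (B₀ δ₀ B₃ : ℝ), 0 < δ₀ ∧ 0 < B₃ ∧
    ∀ (m : ℕ) (n K : ℕ) (_ : 1 ≤ K - n) (_ : K - n + 1 ≤ m + K) {Mh R a' : ℕ} (_ : Mh = (ℓ + 1) ^ a') (_ : Mh₀ ≤ Mh) (_ : R₀ ≤ R) (_ : a' + 3 ≤ m + n)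
      (D : Domains (PV d ℓ m K hd hL)) (_ : D.k = K - n) (_ : Adm22 D R ((ℓ + 1) * Mh))
      (w : ℕ → PBond (PV d ℓ m K hd hL) 0 → ℝ) (_ : IsLevWeight (PV d ℓ m K hd hL) (K - n) D w),
      ∃ (H : (BondIdx D → ℝ) →ₗ[ℝ] (PBond (PV d ℓ m K hd hL) 0 → ℝ)) (Gt : (PBond (PV d ℓ m K hd hL) 0 → ℝ) →ₗ[ℝ] (PBond (PV d ℓ m K hd hL) 0 → ℝ)),
        IsFlatH (PV d ℓ m K hd hL) (K - n) D H ∧ IsFlatGt (PV d ℓ m K hd hL) (K - n) D Gt ∧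
        HSupLetterG (PV d ℓ m K hd hL) (K - n) D w H B₀ ∧ GtSupLetterG (PV d ℓ m K hd hL) (K - n) w Gt B₀ ∧
          GtLaplaceLetterG (PV d ℓ m K hd hL) (K - n) w Gt B₀ ∧
        ∃ dBI : PBond (PV d ℓ m K hd hL) 0 → BondIdx D → ℝ,
          (∀ b c, distBI D b c ≤ dBI b c) ∧ RowSum162 (PV d ℓ m K hd hL) (K - n) D dBI w δ₀ B₃ ∧
            HDecayLetterD (PV d ℓ m K hd hL) (K - n) D dBI w H B₀ δ₀ := by
  obtain ⟨Mh₀, R₀, C, δ₀, B₃, CG, hC, hδ₀, hB₃, hCG, hmain⟩ := rowsAt_of_adm22 d ℓ hd hL hℓ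
  refine ⟨Mh₀, R₀, max (max C (C * B₃)) (CG + max C (C * B₃) * (((ℓ + 1 : ℕ) : ℝ)) * CG), δ₀, B₃, hδ₀, hB₃, ?_⟩
  intro m n K hk1 hk' Mh R a' hMha hMh hR hsize D hDk hAdm w hw
  exact body_of_rowsAt (levWeight_nonneg hw) hCG (Nat.cast_nonneg _) (hmain m n K hk1 hk' hMha hMh hR hsize D hDk hAdm w hw)

/-- **`KernelRowsAt` AT EVERY ADMISSIBLE FAMILY (UNIT CUBES `Λ₀` ALLOWED — NO `Ω₁ = T`) IN THE REGISTERED TEXT's BINDER SHAPE** (`M = Lᵃ`, `a ≥ a₀ + 1`, `R ≥ R₀`; torus size `a₀ + 3 ≤ m + n` only):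
re-chart with the smallest admissible big block `L·L^{a₀}` (`adm22_of_dvd`) and apply file 9's `kernelRowsAt_of_adm22`.
[cite: Balaban1984PropagatorsII, (2.1)-(2.4) p.224, Cor. 2.8 (2.150)-(2.151) p.249; Balaban1985Variational, (161)-(163) p.303] -/
theorem kernelRowsAt_of_adm22_pow (d ℓ : ℕ) (hd : 1 ≤ d + 1) (hL : Odd (ℓ + 1) ∧ 1 < ℓ + 1) (hℓ : 4 ≤ ℓ) :
    ∃ (a₀ R₀ : ℕ) (C δ₀ B₃ CG : ℝ), 0 ≤ C ∧ 0 < δ₀ ∧ 0 < B₃ ∧ 0 ≤ CG ∧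
    ∀ (m : ℕ) (n K : ℕ) (_ : 1 ≤ K - n) (_ : K - n + 1 ≤ m + K) (_ : a₀ + 3 ≤ m + n) {R a : ℕ} (_ : a₀ + 1 ≤ a) (_ : R₀ ≤ R)
      (D : Domains (PV d ℓ m K hd hL)) (_ : D.k = K - n) (_ : Adm22 D R ((ℓ + 1) ^ a))
      (w : ℕ → PBond (PV d ℓ m K hd hL) 0 → ℝ) (_ : IsLevWeight (PV d ℓ m K hd hL) (K - n) D w),
      KernelRowsAt (PV d ℓ m K hd hL) (K - n) D w C δ₀ B₃ CG := by
  obtain ⟨Mh₀, R₀, C, δ₀, B₃, CG, hC, hδ₀, hB₃, hCG, hmain⟩ := kernelRowsAt_of_adm22 d ℓ hd hL hℓ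
  -- `a₀ := Mh₀`: `L^{Mh₀} ≥ Mh₀`
  refine ⟨Mh₀, R₀, C, δ₀, B₃, CG, hC, hδ₀, hB₃, hCG, ?_⟩
  intro m n K hk1 hk' hsize R a ha hR D hDk hAdm w hw
  have hL1 : 1 < ℓ + 1 := by omega
  have hMh : Mh₀ ≤ (ℓ + 1) ^ Mh₀ := (Nat.lt_pow_self hL1).le
  -- re-chart: `L·L^{a₀} ∣ L^a`
  have hdvd : (ℓ + 1) * (ℓ + 1) ^ Mh₀ ∣ (ℓ + 1) ^ a := by
    rw [← pow_succ']
    exact pow_dvd_pow _ (by omega)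
  have hAdm' : Adm22 D R ((ℓ + 1) * (ℓ + 1) ^ Mh₀) := adm22_of_dvd hAdm hdvd
  exact hmain m n K hk1 hk' rfl hMh hR hsize D hDk hAdm' w hw


/-! ## §5 NODE 00's four-tori -/

/-- ★ **THE BODY OF THE P2 TEXT ON NODE 00's FOUR-TORI**: for every `F : T4Family` (d = 4, odd `L > 11`) there are `M_h⁰, R₀ : ℕ` and `B₀, δ₀ > 0, B₃ > 0` such that for all
heights `1 ≤ K − n`, `K − n + 1 ≤ F.m + K`, big blocks `M_h = L^{a′} ≥ M_h⁰`, `R ≥ R₀`, `a′ + 3 ≤ F.m + n`, every nested family `D : Domains (F.P K)` with `D.k = K − n` and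
`Adm22 D R (L·M_h)` (unit cubes `Λ₀` allowed) and every level-weight family `w`: `BodyAt (F.P K) (K − n) D w B₀ δ₀ B₃` — the canonical `H`, `G̃` with the guarded
(46)∕`hG`∕Laplacian letters and a distance `dBI ≥ distBI` carrying (162) and the four (161)₁ rows. [cite: Balaban1985Variational, (46) p.285, (161)-(163) p.303, (165) p.304; Balaban1984PropagatorsII, Prop. 2.6 (2.136) p.247, Cor. 2.8 (2.150)-(2.151) p.249; Balaban1987RG1, (0.1) p.251] -/
theorem body_of_adm22_T4 (F : T4Family) :
    ∃ (Mh₀ R₀ : ℕ) (B₀ δ₀ B₃ : ℝ), 0 < δ₀ ∧ 0 < B₃ ∧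
    ∀ (n K : ℕ) (_ : 1 ≤ K - n) (_ : K - n + 1 ≤ F.m + K) {Mh R a' : ℕ} (_ : Mh = F.L ^ a') (_ : Mh₀ ≤ Mh) (_ : R₀ ≤ R) (_ : a' + 3 ≤ F.m + n)
      (D : Domains (F.P K)) (_ : D.k = K - n) (_ : Adm22 D R (F.L * Mh))
      (w : ℕ → PBond (F.P K) 0 → ℝ) (_ : IsLevWeight (F.P K) (K - n) D w),
      BodyAt (F.P K) (K - n) D w B₀ δ₀ B₃ := by
  obtain ⟨L, hL, h11, m, hm⟩ := F
  obtain ⟨ℓ, rfl⟩ : ∃ ℓ, L = ℓ + 1 := ⟨L - 1, by omega⟩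
  have hℓ : 4 ≤ ℓ := by omega
  obtain ⟨Mh₀, R₀, B₀, δ₀, B₃, hδ₀, hB₃, hmain⟩ := body_of_adm22 3 ℓ K0FlatCubeOpsTextP.hd4 hL hℓ
  refine ⟨Mh₀, R₀, B₀, δ₀, B₃, hδ₀, hB₃, ?_⟩
  intro n K hk1 hk' Mh R a' hMha hMh hR hsize D hDk hAdm w hw
  exact hmain m n K hk1 hk' hMha hMh hR hsize D hDk hAdm w hw

end Summit.QuantumFields.YangMills.Theorems.K0FlatPortBodyP

end
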